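import Mathlib
import Summits.Ventures.PercRepro2.SwOutShadowMultiRootUnits
import Summits.Ventures.PercRepro2.SwOutShadowMultiRootCubePoints
import Summits.Ventures.PercRepro2.SwOutShadowMultiRootBlocks

/-!
# THE FIBRE THEOREM: the rigid inequality on a fibre of the escaping set from the decorated
cubes (blind cell PercRepro2, night-4 g35, 2026-08-29; proofs/NIGHT4-G35.md §4)

The PART of a class with the roots `R ∋ h` non-escaping and the vertices of `T` escaping (a fibre
of the escaping set, `T` the escaping junctions in either colour) satisfies the rigid counting
inequality once every side point of the part carries canonical units that are pure, pairwise
disjoint, attached, clustered (a unit is the cluster of its arm vertices in the red-unit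
configuration of its base), without stray edges (an edge from an arm to the outside of the hull
goes to its decoration or to `l`), inside the region, and every escaping vertex is routed to `l`
inside a unit: **`rigidOK_g_of_decoFibre`** — the block of a side point is the decorated cube of
its canonical base (`decoBaseE_baseDeco`), the side point is a cube point of it
(`decoRealRR_baseDeco_omegaDeco`), the key (base, units) is constant along the cube
(`baseDeco_decoRealRR`, `unitsR_decoRealRR`), the cube stays in the part (the roots' hulls inside
the hull, the routed vertices in the hull of `l` at every cube point), and every block satisfies
the inequality (`card_decoCubeRR_le_g`).  The conditions are the census's (design 10/12 of
mining/night-4/g35): they hold at every side point of 3,562 / 4,868 open pairs at `n = 7`.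
-/

namespace Summit.Ventures.PercRepro2

namespace LocRows

open Hull

universe u v

variable {V : Type u} {E : Type v} [Fintype E] [DecidableEq E]

open scoped Classical

variable {ends : E → Sym2 V} {U : Set V} {ξ : Config E} {l h : V} {R : Set V}
  {𝓤 𝓓 𝓓'' : Set (Set V)} {X : Set V} {𝓤' : Set (Set V)} {F : V → Prop}

/-- The units are clustered: every unit of a side point is the cluster of each of its arm vertices
in the red-unit configuration of its decorated base. -/
def Clustered (ends : E → Sym2 V) (R : Set V) (l : V) (ζ : Config E) : Prop :=
  ∀ u ∈ unitsR ends R l ζ, ∀ y ∈ unitArm ends R ζ u,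
    u = cluster ends (unitConfigB ends R l (baseDeco ends R l ζ)) y

/-- No stray edges: every edge from the arm part of a unit to the outside of the hull goes to the
unit's decoration or to `l`. -/
def NoStray (ends : E → Sym2 V) (R : Set V) (l : V) (ζ : Config E) : Prop :=
  ∀ u ∈ unitsR ends R l ζ, ∀ e x y, ends e = s(x, y) → x ∈ unitArm ends R ζ u →
    y ∉ extHullR ends R ζ → y ∈ unitDeco ends R ζ u ∨ y = l

/-- The key of a side point: its decorated base and its units. -/
noncomputable def decoKey (ends : E → Sym2 V) (R : Set V) (l : V) (ζ : Config E) :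
    Config E × Finset (Set V) :=
  (baseDeco ends R l ζ, unitsR ends R l ζ)

/-- The block of a key: the decorated cube of the base with the units (arm parts and decorations
read off the base's hull). -/
noncomputable def decoBlock (ends : E → Sym2 V) (R : Set V) (p : Config E × Finset (Set V)) :
    Finset (Config E) :=
  decoCubeRR ends (fun u : ↥p.2 => u.1 ∩ extHullR ends R p.1)
    (fun u : ↥p.2 => u.1 \ extHullR ends R p.1) (rrEdges ends R) p.1

/-- **THE FIBRE THEOREM**: the rigid counting inequality on the part of the general doubly typed
side of a class with the roots `R ∋ h` non-escaping and the vertices of `T` escaping, under the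
canonical conditions at every side point of the part. -/
theorem rigidOK_g_of_decoFibre (h𝓤 : IsUpperSet 𝓤) (h𝓓 : IsLowerSet 𝓓) (h𝓓'' : IsLowerSet 𝓓'')
    (h𝓤' : IsUpperSet 𝓤') (hl : l ∉ U) (hh : h ∈ R)
    (hloop : ∀ e r, r ∈ R → ends e ≠ s(r, r))
    (hF : ∀ x, F x → ∀ S ∈ 𝓤, x ∈ S) (T : Set V)
    (hout : ∀ x ∈ U, x ∉ R →
      F x ∨ x ∈ X ∨ (∃ e y, ends e = s(x, y) ∧ y ∉ U) ∨ (∀ e, x ∉ ends e) ∨ x ∈ T)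
    (hX : ∀ x ∈ X, x ∈ U → ∀ e, x ∈ ends e → ends e = s(x, x))
    (hRX : ∀ r ∈ R, r ∉ X)
    (hcan : ∀ ζ ∈ gOutSide ends l h 𝓤 𝓓 𝓓'' X 𝓤' U ξ,
      (∀ r ∈ R, hull ends ζ r ⊆ U) → (∀ u ∈ T, ¬ hull ends ζ u ⊆ U) →
        Pure ends R l ζ ∧ UnitsDisjoint ends R l ζ ∧ Attached ends R l ζ ∧
          Clustered ends R l ζ ∧ NoStray ends R l ζ ∧ (∀ u ∈ unitsR ends R l ζ, u ⊆ U) ∧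
          (∀ u ∈ T, ∃ v ∈ unitsR ends R l ζ,
            u ∈ cluster ends (decoRoute ends v (baseDeco ends R l ζ)) l))
    {𝓔 : Set (Set E)} (h𝓔 : IsUpperSet 𝓔) :
    ((gOutSide ends l h 𝓤 𝓓 𝓓'' X 𝓤' U ξ).filter fun ζ =>
        ((∀ r ∈ R, hull ends ζ r ⊆ U) ∧ (∀ u ∈ T, ¬ hull ends ζ u ⊆ U)) ∧
          redEdges ends ζ h ∈ 𝓔).card ≤
      ((gOutSide ends l h 𝓤 𝓓 𝓓'' X 𝓤' U ξ).filter fun ζ =>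
        ((∀ r ∈ R, hull ends ζ r ⊆ U) ∧ (∀ u ∈ T, ¬ hull ends ζ u ⊆ U)) ∧
          blueEdges ends ζ h ∈ 𝓔).card := by
  -- the structure at a side point of the part
  have hstruct : ∀ ζ ∈ gOutSide ends l h 𝓤 𝓓 𝓓'' X 𝓤' U ξ,
      (∀ r ∈ R, hull ends ζ r ⊆ U) → (∀ u ∈ T, ¬ hull ends ζ u ⊆ U) →
        DecoBaseE ends (baseDeco ends R l ζ) R (extHullR ends R ζ) l
          (fun u : ↥(unitsR ends R l ζ) => unitArm ends R ζ u.1)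
          (fun u : ↥(unitsR ends R l ζ) => unitDeco ends R ζ u.1) (rrEdges ends R) := by
    intro ζ hζ hne hT
    obtain ⟨hP, hD, hA, -, -, -, -⟩ := hcan ζ hζ hne hT
    have hout' : ∀ x ∈ U, x ∉ R → F x ∨ x ∈ X ∨ (∃ e y, ends e = s(x, y) ∧ y ∉ U) ∨
        (∀ e, x ∉ ends e) ∨ ¬ hull ends ζ x ⊆ U := by
      intro x hxU hxR
      rcases hout x hxU hxR with h' | h' | h' | h' | h'
      · exact Or.inl h'
      · exact Or.inr (Or.inl h')
      · exact Or.inr (Or.inr (Or.inl h'))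
      · exact Or.inr (Or.inr (Or.inr (Or.inl h')))
      · exact Or.inr (Or.inr (Or.inr (Or.inr (hT x h'))))
    exact decoBaseE_baseDeco hl hloop hF hout' hX hζ hne hP hD hA
  -- the block of a side point of the part is the decorated cube of its canonical base
  have hblk : ∀ ζ ∈ gOutSide ends l h 𝓤 𝓓 𝓓'' X 𝓤' U ξ,
      (∀ r ∈ R, hull ends ζ r ⊆ U) → (∀ u ∈ T, ¬ hull ends ζ u ⊆ U) →
        decoBlock ends R (decoKey ends R l ζ) =
          decoCubeRR ends (fun u : ↥(unitsR ends R l ζ) => unitArm ends R ζ u.1)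
            (fun u : ↥(unitsR ends R l ζ) => unitDeco ends R ζ u.1) (rrEdges ends R)
            (baseDeco ends R l ζ) := by
    intro ζ hζ hne hT
    have hH : extHullR ends R (baseDeco ends R l ζ) = extHullR ends R ζ :=
      (hstruct ζ hζ hne hT).extHullR_base
    show decoCubeRR ends (fun u : ↥(unitsR ends R l ζ) => u.1 ∩ extHullR ends R (baseDeco ends R l ζ))
      (fun u : ↥(unitsR ends R l ζ) => u.1 \ extHullR ends R (baseDeco ends R l ζ)) (rrEdges ends R)
      (baseDeco ends R l ζ) = _
    rw [hH]
    rfl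
  have hout' : ∀ ζ, (∀ u ∈ T, ¬ hull ends ζ u ⊆ U) → ∀ x ∈ U, x ∉ R →
      F x ∨ x ∈ X ∨ (∃ e y, ends e = s(x, y) ∧ y ∉ U) ∨ (∀ e, x ∉ ends e) ∨
        ¬ hull ends ζ x ⊆ U := by
    intro ζ hT x hxU hxR
    rcases hout x hxU hxR with h' | h' | h' | h' | h'
    · exact Or.inl h'
    · exact Or.inr (Or.inl h')
    · exact Or.inr (Or.inr (Or.inl h'))
    · exact Or.inr (Or.inr (Or.inr (Or.inl h')))
    · exact Or.inr (Or.inr (Or.inr (Or.inr (hT x h'))))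
  have main := rigidOK_g_of_decoCubes (ends := ends) (U := U) (ξ := ξ) (l := l) (h := h) (X := X)
    h𝓤 h𝓓 h𝓓'' h𝓤' (decoKey ends R l) (decoBlock ends R)
    (fun ζ => (∀ r ∈ R, hull ends ζ r ⊆ U) ∧ (∀ u ∈ T, ¬ hull ends ζ u ⊆ U)) ?_ ?_ ?_ h𝓔
  · convert main using 3
  · -- every side point of the part lies in its block
    intro ζ hζ ⟨hne, hT⟩
    rw [hblk ζ hζ hne hT, mem_decoCubeRR]
    exact ⟨omegaDeco ends R l ζ, decoRealRR_baseDeco_omegaDeco hl hF (hout' ζ hT) hX hζ hne⟩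
  · -- every side point of a block lies in the part with the same key
    intro ζ hζ ⟨hne, hT⟩ ζ' hζ' hQ
    obtain ⟨-, -, -, hC, hN, hZU, hroute⟩ := hcan ζ hζ hne hT
    have hb := hstruct ζ hζ hne hT
    rw [hblk ζ hζ hne hT, mem_decoCubeRR] at hζ'
    obtain ⟨ω, rfl⟩ := hζ'
    have hN' : ∀ i : ↥(unitsR ends R l ζ), ∀ e x y, ends e = s(x, y) → x ∈ unitArm ends R ζ i.1 →
        y ∉ extHullR ends R ζ → y ∈ unitDeco ends R ζ i.1 ∨ y = l :=
      fun i e x y hxy hx hy => hN i.1 i.2 e x y hxy hx hy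
    have hC' : ∀ i : ↥(unitsR ends R l ζ), ∀ y ∈ unitArm ends R ζ i.1,
        unitAZ (fun u : ↥(unitsR ends R l ζ) => unitArm ends R ζ u.1)
          (fun u : ↥(unitsR ends R l ζ) => unitDeco ends R ζ u.1) i =
          cluster ends (unitConfigB ends R l (baseDeco ends R l ζ)) y := by
      intro i y hy
      show unitArm ends R ζ i.1 ∪ unitDeco ends R ζ i.1 = _
      rw [unitArm_union_unitDeco]
      exact hC i.1 i.2 y hy
    have hHU : extHullR ends R ζ ⊆ U := Esc.extHullR_subset_U hne
    have hZU' : ∀ i : ↥(unitsR ends R l ζ), unitDeco ends R ζ i.1 ⊆ U :=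
      fun i z hz => hZU i.1 i.2 hz.1
    -- the base lies in the class: it agrees with the side point off the edges touching `U`
    have hbase : baseDeco ends R l ζ ∈ outClass ends U h ξ := by
      have hcl := mem_outClass.1 (mem_gOutSide.1 hζ).2
      rw [mem_outClass]
      refine ⟨fun e he => ?_, ?_⟩
      · rw [← hcl.1 e he]
        by_cases hrr : e ∈ rrEdges ends R
        · exfalso
          obtain ⟨r, hr, r', -, hrr'⟩ := mem_rrEdges.1 hrr
          exact he ⟨r, hHU (mem_extHullR_of_mem hr), r', hrr'⟩
        · rw [baseDeco_apply_of_notMem hrr, flip_apply_of_notMem]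
          rintro ⟨x, ⟨y, hy, hx⟩, w, hxw⟩
          apply he
          refine ⟨x, ?_, w, hxw⟩
          have hyH : y ∈ extHullR ends R ζ := bluePartR_subset hy
          exact hZU _ (unitOf_mem_unitsR_of_mem hl hF (hout' ζ hT) hX hζ hne hyH hy.2) hx
      · have := hb.hull_subset (fun _ => true) hh
        rw [DecoBaseE.decoRealRR_top] at this
        exact this.trans hHU
    refine ⟨mem_gOutSide.2 ⟨hQ, hb.decoRealRR_mem_outClass hh hHU hZU' hbase ω⟩,
      ⟨fun r hr => (hb.hull_subset ω hr).trans hHU, fun u hu hsub => ?_⟩, ?_⟩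
    · -- a routed vertex is in the hull of `l` at every cube point; `l ∉ U`
      obtain ⟨v, hv, hroute'⟩ := hroute u hu
      have hmem := hb.routed_mem_hull_l ω (i := ⟨v, hv⟩) (by
        show u ∈ cluster ends (decoRoute ends (unitArm ends R ζ v ∪ unitDeco ends R ζ v) _) l
        rw [unitArm_union_unitDeco]
        exact hroute')
      apply hl
      rcases hmem with hmem | hmem
      · exact hsub (Or.inl (conn_symm hmem))
      · exact hsub (Or.inr (conn_symm hmem))
    · -- the key is constant along the cube
      simp only [decoKey]
      rw [hb.baseDeco_decoRealRR rfl hN' hC' ω, hb.unitsR_decoRealRR hN' hC' ω]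
      congr 1
      have key := decoRealRR_baseDeco_omegaDeco hl hF (hout' ζ hT) hX hζ hne (R := R) (l := l)
        (ζ := ζ)
      have := hb.unitsR_decoRealRR hN' hC' (omegaDeco ends R l ζ)
      rw [key] at this
      exact this.symm
  · -- every block is the decorated cube of a decorated base
    intro ζ hζ ⟨hne, hT⟩
    have hb := hstruct ζ hζ hne hT
    exact ⟨↥(unitsR ends R l ζ), inferInstance, baseDeco ends R l ζ, R, extHullR ends R ζ,
      fun u => unitArm ends R ζ u.1, fun u => unitDeco ends R ζ u.1, rrEdges ends R, hb, hh,
      fun x hx => X_notMem_extHullR hRX hne hX hx, hblk ζ hζ hne hT⟩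

end LocRows

end Summit.Ventures.PercRepro2
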